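import Summits.CriticalPhenomena.PercolationContinuityZ3.Theorems.PercNearOneGluingNoHeavyLowerTailSahiSunflowerAllOrders
import Summits.CriticalPhenomena.PercolationContinuityZ3.Theorems.PercNearOneGluingNoHeavyLowerTailTIncRowPartial
import Literature.Combinatorics.Sahi2008.Percolation
import Literature.Combinatorics.Sahi2008.PushForward
import HarnessLib

/-!
# `NoHeavyLowerTail` (crux stmt-CriticalPhenomena-4575), master-family line P2: the INCREASING 3-point pattern algebra —
# all orders of Sahi's hierarchy ⟺ the open row `T_inc`; unconditional in the sparse regime `μ(abc) ≤ μ(a|b|c)`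

Support file (seat `prim-masterthm-p2`, `--supports stmt-CriticalPhenomena-4575 --as helper`); no named fact, no sorry.
Companion of `…SahiSunflowerAllOrders.lean` (`M3.sahiPositive_m3_iff`) and `…SahiSunflowerAllOrdersThreePoint.lean` (the
DECREASING side, unconditional from `3PT-LB`).

Orient the five-point sunflower poset `M₃` the other way: `pat3inc a b c : BondConfig V → M₃` sends 'no pair of `a,b,c`
joined' to `core`, 'exactly the pair `bc / ac / ab` joined' to `pet 0 / 1 / 2`, 'all joined' to `out` (a MONOTONE map of the
configuration).  The up-sets `D 0, D 1, D 2` of `M₃` pull back to the increasing events `N_a = {a~b} ∪ {a~c}`,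
`N_b = {a~b} ∪ {b~c}`, `N_c = {a~c} ∪ {b~c}` ('the vertex is not isolated from the other two') of `TIncRow`
(`setInd_D_comp_pat3inc`), so the cubic of the pushed-forward weight is `T_inc = E₃(N_a, N_b, N_c)` (`pat3inc_cubic_eq`).
* `sahiPositive_pat3inc_iff` — for every finite weighted graph and `a b c`: the increasing 3-point pattern weight is
  Sahi-positive of EVERY order iff `T_inc ≥ 0` — the open row (`TIncRow`: `= (1+q)·AG − e₃`, open when `μ(abc) > μ(a|b|c)`)
  is EXACTLY the whole hierarchy of this algebra;
* `sahiPositive_pat3inc_of_le`, `sahiE_threePointPatternInc_nonneg_of_le` — unconditional in the sparse regime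
  `μ(abc) ≤ μ(a|b|c)` (from `TIncRow.sahiE3_nonIsol_nonneg_of_le`): there every `E_n` of nonnegative pattern-measurable
  functions INCREASING in the configuration is `≥ 0`.
-/

noncomputable section

namespace Summit.CriticalPhenomena.PercolationContinuityZ3.Theorems.SahiDeltaSystem

open Finset Function MeasureTheory Literature.Combinatorics.Sahi2008
open Literature.Probability.LatticeModels (prodBernoulli sahiE3)
open Literature.Probability.Percolation
open Literature.Probability.Percolation.DecisionTree (ind ind_of_mem ind_of_not_mem ind_nonneg)
open M3

variable {V : Type*} [Fintype V]

/-- The increasing-orientation pattern map: `core` = no pair of `a,b,c` joined, `pet 0/1/2` = exactly `bc/ac/ab` joined,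
`out` = all joined. [this work] -/
def pat3inc (a b c : V) (ω : BondConfig V) : M3 := by
  classical
  exact if ¬ (ω ∈ openConn a b) ∧ ¬ (ω ∈ openConn a c) ∧ ¬ (ω ∈ openConn b c) then core
    else if ω ∈ openConn a b ∧ ω ∈ openConn a c then out
    else if ω ∈ openConn b c then pet 0 else if ω ∈ openConn a c then pet 1 else pet 2

omit [Fintype V] in
/-- The up-sets `D i` pull back along `pat3inc` to the 'not isolated' events `N_a, N_b, N_c`. [this work] -/
theorem setInd_D_comp_pat3inc (a b c : V) :
    (setInd (D 0) ∘ pat3inc a b c = ind (openConn a b ∪ openConn a c)) ∧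
      (setInd (D 1) ∘ pat3inc a b c = ind (openConn a b ∪ openConn b c)) ∧
        (setInd (D 2) ∘ pat3inc a b c = ind (openConn a c ∪ openConn b c)) := by
  have tr1 : ∀ ω : BondConfig V, ω ∈ openConn a b → ω ∈ openConn a c → ω ∈ openConn b c :=
    fun ω h1 h2 => SimpleGraph.Reachable.trans (SimpleGraph.Reachable.symm h1) h2
  have tr2 : ∀ ω : BondConfig V, ω ∈ openConn a b → ω ∈ openConn b c → ω ∈ openConn a c :=
    fun ω h1 h2 => SimpleGraph.Reachable.trans h1 h2
  have tr3 : ∀ ω : BondConfig V, ω ∈ openConn a c → ω ∈ openConn b c → ω ∈ openConn a b :=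
    fun ω h1 h2 => SimpleGraph.Reachable.trans h1 (SimpleGraph.Reachable.symm h2)
  refine ⟨?_, ?_, ?_⟩ <;> funext ω <;>
    simp only [Function.comp, setInd_apply, D, Finset.mem_erase, Finset.mem_univ, pat3inc, ind, Set.mem_union] <;>
    by_cases h1 : ω ∈ openConn a b <;> by_cases h2 : ω ∈ openConn a c <;> by_cases h3 : ω ∈ openConn b c <;>
    simp (config := { decide := true }) [h1, h2, h3] <;>
    first | exact absurd (tr1 ω h1 h2) h3 | exact absurd (tr2 ω h1 h3) h2 | exact absurd (tr3 ω h2 h3) h1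

/-- **The cubic of the increasing 3-point pattern weight is `T_inc`.** [this work] -/
theorem pat3inc_cubic_eq (w : Sym2 V → unitInterval) (a b c : V) :
    sahiE (pushWeight (bernoulliWeight w) (pat3inc a b c)) 3 ![setInd (D 0), setInd (D 1), setInd (D 2)] =
      sahiE3 (prodBernoulli w) (openConn a b ∪ openConn a c) (openConn a b ∪ openConn b c)
        (openConn a c ∪ openConn b c) := by
  rw [sahiE_pushWeight]
  obtain ⟨h0, h1, h2⟩ := setInd_D_comp_pat3inc (V := V) a b c
  have e : (fun i => (![setInd (D 0), setInd (D 1), setInd (D 2)] : Fin 3 → M3 → ℝ) i ∘ pat3inc a b c) =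
      ![ind (openConn a b ∪ openConn a c), ind (openConn a b ∪ openConn b c), ind (openConn a c ∪ openConn b c)] := by
    funext i
    fin_cases i
    · exact h0
    · exact h1
    · exact h2
  rw [e, sahiE_three_ind]

/-- **All orders ⟺ `T_inc`.**  For every finite weighted graph and vertices `a b c`, the increasing 3-point pattern weight is
Sahi-positive of EVERY order iff the single (open) row `T_inc = E₃(N_a, N_b, N_c) ≥ 0` holds. [this work] -/
theorem sahiPositive_pat3inc_iff (w : Sym2 V → unitInterval) (a b c : V) :
    (∀ n, SahiPositive (pushWeight (bernoulliWeight w) (pat3inc a b c)) n) ↔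
      0 ≤ sahiE3 (prodBernoulli w) (openConn a b ∪ openConn a c) (openConn a b ∪ openConn b c)
        (openConn a c ∪ openConn b c) := by
  have hν0 : ∀ x, 0 ≤ pushWeight (bernoulliWeight w) (pat3inc a b c) x :=
    fun x => pushWeight_nonneg (isFKGMeasure_bernoulliWeight w).nonneg _ x
  have hν1 : ∑ x, pushWeight (bernoulliWeight w) (pat3inc a b c) x = 1 := by
    rw [sum_pushWeight, sum_bernoulliWeight]
  rw [sahiPositive_m3_iff hν0 hν1, ← sahiE_three_D hν1, pat3inc_cubic_eq]

/-- **Sparse regime, unconditional.**  If `μ(a~b~c) ≤ μ(a|b|c)` then the increasing 3-point pattern weight is Sahi-positive of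
every order (from `TIncRow.sahiE3_nonIsol_nonneg_of_le`). [this work] -/
theorem sahiPositive_pat3inc_of_le (w : Sym2 V → unitInterval) (a b c : V)
    (hqt : (prodBernoulli w).real (openConn a b ∩ openConn a c) ≤
      (prodBernoulli w).real ((openConn a b)ᶜ ∩ (openConn a c)ᶜ ∩ (openConn b c)ᶜ)) (n : ℕ) :
    SahiPositive (pushWeight (bernoulliWeight w) (pat3inc a b c)) n :=
  (sahiPositive_pat3inc_iff w a b c).2 (TIncRow.sahiE3_nonIsol_nonneg_of_le w a b c hqt) n

/-- **Sparse regime: every `E_n` of increasing 3-point pattern functions is nonnegative.**  For `μ(a~b~c) ≤ μ(a|b|c)`, all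
`n` and all nonnegative `f_i : M₃ → ℝ` increasing from `core` (= nothing joined) to `out` (= all joined):
`E_n(f₀ ∘ pat3inc, …, f_{n−1} ∘ pat3inc) ≥ 0` under the percolation weight. [this work] -/
theorem sahiE_threePointPatternInc_nonneg_of_le (w : Sym2 V → unitInterval) (a b c : V)
    (hqt : (prodBernoulli w).real (openConn a b ∩ openConn a c) ≤
      (prodBernoulli w).real ((openConn a b)ᶜ ∩ (openConn a c)ᶜ ∩ (openConn b c)ᶜ))
    {n : ℕ} (f : Fin n → M3 → ℝ) (hf0 : ∀ i x, 0 ≤ f i x) (hmono : ∀ i, Monotone (f i)) :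
    0 ≤ sahiE (bernoulliWeight w) n fun i => f i ∘ pat3inc a b c := by
  rw [← sahiE_pushWeight]
  exact sahiPositive_pat3inc_of_le w a b c hqt n f hf0 hmono

end Summit.CriticalPhenomena.PercolationContinuityZ3.Theorems.SahiDeltaSystem
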